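import Literature.MathematicalPhysics.QuantumManyBody.GroundStateFeynmanKacOperatorProps
import Literature.MathematicalPhysics.QuantumManyBody.GroundStateFeynmanKacCompact
import Literature.MathematicalPhysics.QuantumManyBody.GroundStateFeynmanKacInteraction
import Literature.MathematicalPhysics.QuantumManyBody.GroundStateFeynmanKacExitBound
import Mathlib.Analysis.InnerProductSpace.Adjoint
import Mathlib.Analysis.SpecialFunctions.Pow.Deriv
import Mathlib.Analysis.Calculus.Deriv.Slope
import HarnessLib

/-!
# Ground state of the Feynman–Kac semigroup, XVI: the energy is at least `−log ‖e^{−H_N}‖`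

Part of the proof of `GroundStateFeynmanKac` (Chung–Zhao (1995), Thm 3.17 with Thm 3.27 /
Prop 3.29 (81): the top of the spectrum of the Feynman–Kac semigroup is the variational supremum of
`−(½∫|∇f|² − ∫ q f²)` over the form domain; here with generator `Δ − V`).  We prove the
**lower bound half** `λ₀ := −log ‖T_1‖ ≤ groundStateEnergy v N L` directly from the semigroup,
by the small-time expansion of `t⁻¹⟨f, f − T_t f⟩` on `C¹` Dirichlet functions:

* `norm_fkL2_two_mul`, `norm_fkL2_dyadic` — `‖T_{2s}‖ = ‖T_s‖²` (self-adjointness, the `C*`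
  identity), hence `‖T_{2^{-n}}‖ = ‖T_1‖^{2^{-n}}`;
* `setIntegral_mul_fkReal_le` — `⟨f, T_t f⟩ ≤ ‖T_t‖ ‖f‖²`;
* `pairing_shift_sub_fkReal_le` — `⟨f, P_t f⟩ − ⟨f, T_t f⟩ ≤ K_t(f) + J_t(f)`, the free heat
  semigroup `P_t` minus the killed, weighted one is controlled by the exit term `K_t` of
  `GroundStateFeynmanKacExitBound` and the interaction term `J_t` of
  `GroundStateFeynmanKacInteraction` (`1 − w_t ≤ 𝟙{τ ≤ t} + ∫₀ᵗ V(B_s) ds`);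
* `realKinetic_lower_bound` — for real `C¹` `f` vanishing off the box,
  `λ₀ ∫ f² ≤ ∫ |∇f|² + ∫ V f²` (combine along `t = 2^{-n} → 0` with the square identity and the
  `C¹` bound `sqIncr t f ≤ 2t ∫|∇f|²` of `GroundStateFeynmanKacFreeForm`, `K_t = O(t^{3/2})`,
  `J_t/t → ∫ V f²`, and `(1 − μ₀^t)/t → −log μ₀`);
* `ofReal_negLog_le_energy`, `ofReal_negLog_le_groundStateEnergy` — the complex trial states of
  `groundStateEnergy` reduce to their real and imaginary parts.

## References

* K. L. Chung, Z. Zhao, *From Brownian Motion to Schrödinger's Equation* (1995), Thm 3.17,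
  Thm 3.27, Prop 3.29 (81). [cite: ChungZhao1995, Prop 3.29]
* M. Fukushima, Y. Oshima, M. Takeda, *Dirichlet Forms and Symmetric Markov Processes* (2011),
  Lemma 1.3.4. [folklore]
-/

noncomputable section

namespace Literature.MathematicalPhysics.QuantumManyBody.BoseGas

open MeasureTheory ProbabilityTheory Filter Set
open scoped ENNReal NNReal Topology InnerProductSpace
open Literature.Probability.Process

variable {N : ℕ}

/-! ### Operator norms at dyadic times -/

section Norms

variable {v : ℝ → ℝ≥0∞} {L : ℝ}

/-- **`‖T_{2s}‖ = ‖T_s‖²`** (`T_{2s} = T_s T_s = T_s^* T_s` and the `C*` identity).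
[cite: ChungZhao1995, Thm 3.17] -/
theorem norm_fkL2_two_mul (hv : Measurable v) (L : ℝ) {s : ℝ} (hs : 0 < s) :
    ‖fkL2 (N := N) v L (2 * s)‖ = ‖fkL2 (N := N) v L s‖ ^ 2 := by
  rw [two_mul, fkL2_add_time hv L hs hs]
  have hsa := isSelfAdjoint_fkL2 (N := N) hv L hs
  rw [ContinuousLinearMap.isSelfAdjoint_iff'] at hsa
  have h : (fkL2 v L s).comp (fkL2 v L s) =
      (ContinuousLinearMap.adjoint (fkL2 v L s)) ∘L (fkL2 (N := N) v L s) := by rw [hsa]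
  rw [h, ContinuousLinearMap.norm_adjoint_comp_self, sq]

/-- **`‖T_{2^{-n}}‖ = ‖T_1‖^{2^{-n}}`.** [cite: ChungZhao1995, Thm 3.17] -/
theorem norm_fkL2_dyadic (hv : Measurable v) (L : ℝ) (n : ℕ) :
    ‖fkL2 (N := N) v L (((2 : ℝ) ^ n)⁻¹)‖ = ‖fkL2 (N := N) v L 1‖ ^ (((2 : ℝ) ^ n)⁻¹) := by
  have key : ∀ n : ℕ, ‖fkL2 (N := N) v L 1‖ = ‖fkL2 (N := N) v L (((2 : ℝ) ^ n)⁻¹)‖ ^ (2 ^ n) := by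
    intro n
    induction n with
    | zero => simp
    | succ n ih =>
      have hpos : (0 : ℝ) < ((2 : ℝ) ^ (n + 1))⁻¹ := by positivity
      have h2 : ((2 : ℝ) ^ n)⁻¹ = 2 * ((2 : ℝ) ^ (n + 1))⁻¹ := by
        rw [pow_succ]; field_simp
      rw [ih, h2, norm_fkL2_two_mul hv L hpos, ← pow_mul]
      ring
  have hnn : 0 ≤ ‖fkL2 (N := N) v L (((2 : ℝ) ^ n)⁻¹)‖ := norm_nonneg _
  rw [key n]
  conv_rhs => arg 2; rw [show (((2 : ℝ) ^ n)⁻¹) = ((2 ^ n : ℕ) : ℝ)⁻¹ by push_cast; ring]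
  exact (Real.pow_rpow_inv_natCast hnn (pow_ne_zero n two_ne_zero)).symm

end Norms

/-! ### The pairing `⟨f, T_t f⟩ ≤ ‖T_t‖ ‖f‖²` -/

section Pairing

variable {v : ℝ → ℝ≥0∞} {L : ℝ}

/-- **`∫_Λ f · T_t f ≤ ‖T_t‖ ∫_Λ f²`** for bounded measurable `f` (`t > 0`).
[cite: ChungZhao1995, Thm 3.17] -/
theorem setIntegral_mul_fkReal_le (hv : Measurable v) (L : ℝ) {t : ℝ} (ht : 0 < t)
    {f : Config N → ℝ} (hf : Measurable f) {M : ℝ} (hM : ∀ x, |f x| ≤ M) :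
    ∫ x in boxN N L, f x * fkReal v L t f x ≤
      ‖fkL2 (N := N) v L t‖ * ∫ x in boxN N L, f x ^ 2 := by
  set μ : Measure (Config N) := volume.restrict (boxN N L) with hμ
  haveI : IsFiniteMeasure μ := ⟨by rw [hμ, Measure.restrict_apply_univ]; exact volume_boxN_lt_top N L⟩
  have hmem : MemLp f 2 μ := MemLp.of_bound hf.aestronglyMeasurable M
    (Eventually.of_forall fun x => by rw [Real.norm_eq_abs]; exact hM x)
  set fL : Lp ℝ 2 μ := hmem.toLp f with hfLdef
  have hfL : (fL : Config N → ℝ) =ᵐ[μ] f := hmem.coeFn_toLp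
  have hinner : ⟪fL, fkL2 v L t fL⟫_ℝ = ∫ x in boxN N L, f x * fkReal v L t f x := by
    rw [L2.inner_def]
    refine integral_congr_ae ?_
    filter_upwards [hfL, fkL2_coeFn hv L ht fL] with x h1 h2
    rw [RCLike.inner_apply, conj_trivial, h2, h1, fkReal_congr_ae_restrict v L ht hfL x, mul_comm]
  have hnorm : ‖fL‖ ^ 2 = ∫ x in boxN N L, f x ^ 2 := by
    rw [← real_inner_self_eq_norm_sq, L2.inner_def]
    refine integral_congr_ae ?_
    filter_upwards [hfL] with x h1
    rw [RCLike.inner_apply, conj_trivial, h1, sq]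
  rw [← hinner, ← hnorm]
  calc ⟪fL, fkL2 v L t fL⟫_ℝ ≤ ‖fL‖ * ‖fkL2 v L t fL‖ := real_inner_le_norm _ _
    _ ≤ ‖fL‖ * (‖fkL2 (N := N) v L t‖ * ‖fL‖) := by
        gcongr; exact ContinuousLinearMap.le_opNorm _ _
    _ = ‖fkL2 (N := N) v L t‖ * ‖fL‖ ^ 2 := by ring

end Pairing

/-! ### `1 − w_t ≤ 𝟙{τ ≤ t} + ∫₀ᵗ V` -/

/-- Pointwise: `1 − w_t(X, ω) ≤ 𝟙{τ_Λ ≤ t}(ω) + ∫₀ᵗ V(B_s) ds` (in `[0, ∞]`, the real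
`1 − w` read through `ofReal`). [folklore] -/
theorem ofReal_one_sub_fkWeight_le (v : ℝ → ℝ≥0∞) (L t : ℝ) (X : Config N) (ω : PathSpace N) :
    ENNReal.ofReal (1 - (fkWeight v L t X ω).toReal) ≤
      (survives L t X)ᶜ.indicator (1 : PathSpace N → ℝ≥0∞) ω + pathAction v t X ω := by
  by_cases hω : ω ∈ survives L t X
  · rw [indicator_of_notMem (notMem_compl_iff.2 hω), zero_add, fkWeight, indicator_of_mem hω,
      expNeg]
    split_ifs with htop
    · rw [htop]; exact le_top
    · rw [ENNReal.toReal_ofReal (Real.exp_nonneg _)]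
      calc ENNReal.ofReal (1 - Real.exp (-(pathAction v t X ω).toReal))
          ≤ ENNReal.ofReal ((pathAction v t X ω).toReal) :=
            ENNReal.ofReal_le_ofReal (by linarith [Real.add_one_le_exp (-(pathAction v t X ω).toReal)])
        _ = pathAction v t X ω := ENNReal.ofReal_toReal htop
  · rw [indicator_of_mem (mem_compl hω), fkWeight, indicator_of_notMem hω]
    simp

/-! ### `⟨f, P_t f⟩ − ⟨f, T_t f⟩ ≤ K_t + J_t` -/

section Difference

variable {v : ℝ → ℝ≥0∞} {C : ℝ≥0} {L : ℝ}

/-- The interaction action is jointly measurable in (starting point, sample). [folklore] -/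
theorem measurable_pathAction_uncurry (hv : Measurable v) (t : ℝ) :
    Measurable fun p : Config N × PathSpace N => pathAction v t p.1 p.2 := by
  have h : Measurable fun q : (Config N × PathSpace N) × ℝ =>
      interaction v (worldLine q.1.1 q.1.2 q.2.toNNReal) :=
    (measurable_interaction hv).comp (measurable_worldLine₃.comp
      ((measurable_fst.comp measurable_fst).prodMk ((measurable_snd.comp measurable_fst).prodMk
        measurable_snd)))
  exact h.lintegral_prod_right'

/-- **The free semigroup minus the killed, weighted one**: for bounded measurable `f` vanishing
off the box and `t > 0`,
`∫ f(x) E[f(x + √2 b_t)] dx − ∫_Λ f · T_t f ≤ K_t(f) + J_t(f)` with the exit term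
`K_t(f) = ∫ dx E[𝟙{τ ≤ t} |f(x)| |f(x + √2 b_t)|]` and the interaction term
`J_t(f) = ∫ |f(x)| E_x[(∫₀ᵗ V(B_s)ds) |f(B_t)|] dx` (from `1 − w_t ≤ 𝟙{τ ≤ t} + ∫₀ᵗ V`).
[cite: ChungZhao1995, Prop 3.29] -/
theorem pairing_shift_sub_fkReal_le (hv : Measurable v) (hC : ∀ r, v r ≤ C) (L : ℝ)
    {t : ℝ≥0} (ht : 0 < t) {f : Config N → ℝ} (hf : Measurable f) {M : ℝ} (hM : ∀ x, |f x| ≤ M)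
    (hzero : ∀ x, x ∉ boxN N L → f x = 0) :
    (∫ x, f x * ∫ ω, f (x + displacement t ω) ∂wienerPaths N) -
        ∫ x in boxN N L, f x * fkReal v L t f x ≤
      ((∫⁻ x, ∫⁻ ω, (survives L t x)ᶜ.indicator (1 : PathSpace N → ℝ≥0∞) ω *
          (‖f x‖ₑ * ‖f (x + displacement t ω)‖ₑ) ∂wienerPaths N) +
        ∫⁻ x, ‖f x‖ₑ * ∫⁻ ω, pathAction v t x ω * ‖f (worldLine x ω t)‖ₑ ∂wienerPaths N).toReal := by
  have hM0 : 0 ≤ M := (abs_nonneg _).trans (hM 0)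
  have ht' : (0 : ℝ) < t := ht
  -- the weight, read in `ℝ`
  have hw01 : ∀ (x : Config N) (ω : PathSpace N),
      0 ≤ (fkWeight v L t x ω).toReal ∧ (fkWeight v L t x ω).toReal ≤ 1 := fun x ω =>
    ⟨ENNReal.toReal_nonneg, ENNReal.toReal_le_of_le_ofReal zero_le_one
      (by rw [ENNReal.ofReal_one]; exact fkWeight_le_one v L t x ω)⟩
  -- joint measurability of the two shifted integrands
  have hshift : Measurable fun p : Config N × PathSpace N => f (p.1 + displacement t p.2) :=
    hf.comp (measurable_fst.add ((measurable_displacement t).comp measurable_snd))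
  have hwm : Measurable fun p : Config N × PathSpace N => (fkWeight v L t p.1 p.2).toReal :=
    (measurable_fkWeight_uncurry hv L t).ennreal_toReal
  -- `P_t f` and `T_t f` and their bounds
  have hP_meas : Measurable fun x => ∫ ω, f (x + displacement t ω) ∂wienerPaths N :=
    (hshift.stronglyMeasurable.integral_prod_right' (ν := wienerPaths N)).measurable
  have hP_bd : ∀ x, |∫ ω, f (x + displacement t ω) ∂wienerPaths N| ≤ M := fun x => by
    have h := norm_integral_le_of_norm_le_const (μ := wienerPaths N)
      (f := fun ω => f (x + displacement t ω)) (C := M)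
      (Eventually.of_forall fun ω => by rw [Real.norm_eq_abs]; exact hM _)
    rwa [probReal_univ, mul_one, Real.norm_eq_abs] at h
  have hT_eq : ∀ x, fkReal v L t f x =
      ∫ ω, (fkWeight v L t x ω).toReal * f (x + displacement t ω) ∂wienerPaths N := fun x => by
    simp only [fkReal, Real.toNNReal_coe]
    rfl
  have hT_bd : ∀ x, |fkReal v L t f x| ≤ M := fun x => by
    rw [hT_eq x]
    have h := norm_integral_le_of_norm_le_const (μ := wienerPaths N)
      (f := fun ω => (fkWeight v L t x ω).toReal * f (x + displacement t ω)) (C := M)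
      (Eventually.of_forall fun ω => by
        rw [Real.norm_eq_abs, abs_mul, abs_of_nonneg (hw01 x ω).1]
        calc (fkWeight v L t x ω).toReal * |f (x + displacement t ω)| ≤ 1 * M :=
              mul_le_mul (hw01 x ω).2 (hM _) (abs_nonneg _) zero_le_one
          _ = M := one_mul M)
    rwa [probReal_univ, mul_one, Real.norm_eq_abs] at h
  -- integrability on the box
  haveI : IsFiniteMeasure (volume.restrict (boxN N L) : Measure (Config N)) :=
    ⟨by rw [Measure.restrict_apply_univ]; exact volume_boxN_lt_top N L⟩
  have hint1 : Integrable (fun x => f x * ∫ ω, f (x + displacement t ω) ∂wienerPaths N)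
      (volume.restrict (boxN N L)) :=
    (integrable_const (M * M)).mono' (hf.mul hP_meas).aestronglyMeasurable
      (Eventually.of_forall fun x => by
        rw [Real.norm_eq_abs, abs_mul]; exact mul_le_mul (hM x) (hP_bd x) (abs_nonneg _) hM0)
  have hint2 : Integrable (fun x => f x * fkReal v L t f x) (volume.restrict (boxN N L)) :=
    (integrable_const (M * M)).mono' (hf.mul (measurable_fkReal hv L t hf)).aestronglyMeasurable
      (Eventually.of_forall fun x => by
        rw [Real.norm_eq_abs, abs_mul]; exact mul_le_mul (hM x) (hT_bd x) (abs_nonneg _) hM0)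
  -- the difference inside
  have hdiff : ∀ x, f x * (∫ ω, f (x + displacement t ω) ∂wienerPaths N) - f x * fkReal v L t f x =
      f x * ∫ ω, (1 - (fkWeight v L t x ω).toReal) * f (x + displacement t ω) ∂wienerPaths N := by
    intro x
    have hi1 : Integrable (fun ω => f (x + displacement t ω)) (wienerPaths N) :=
      (integrable_const M).mono' (hf.comp ((measurable_displacement t).const_add x)).aestronglyMeasurable
        (Eventually.of_forall fun ω => by rw [Real.norm_eq_abs]; exact hM _)
    have hi2 : Integrable (fun ω => (fkWeight v L t x ω).toReal * f (x + displacement t ω))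
        (wienerPaths N) :=
      (integrable_const M).mono' (((measurable_fkWeight hv L t x).ennreal_toReal).mul
        (hf.comp ((measurable_displacement t).const_add x))).aestronglyMeasurable
        (Eventually.of_forall fun ω => by
          rw [Real.norm_eq_abs, abs_mul, abs_of_nonneg (hw01 x ω).1]
          calc (fkWeight v L t x ω).toReal * |f (x + displacement t ω)| ≤ 1 * M :=
                mul_le_mul (hw01 x ω).2 (hM _) (abs_nonneg _) zero_le_one
            _ = M := one_mul M)
    rw [hT_eq x, ← mul_sub, ← integral_sub hi1 hi2]
    congr 1
    refine integral_congr_ae (Eventually.of_forall fun ω => ?_)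
    ring
  -- the nonnegative majorant `g`
  have hGm : Measurable fun p : Config N × PathSpace N =>
      (1 - (fkWeight v L t p.1 p.2).toReal) * |f (p.1 + displacement t p.2)| :=
    (measurable_const.sub hwm).mul hshift.abs
  have hg_meas : Measurable fun x => |f x| *
      ∫ ω, (1 - (fkWeight v L t x ω).toReal) * |f (x + displacement t ω)| ∂wienerPaths N :=
    hf.abs.mul (hGm.stronglyMeasurable.integral_prod_right' (ν := wienerPaths N)).measurable
  have hg0 : ∀ x, 0 ≤ |f x| *
      ∫ ω, (1 - (fkWeight v L t x ω).toReal) * |f (x + displacement t ω)| ∂wienerPaths N :=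
    fun x => mul_nonneg (abs_nonneg _) (integral_nonneg fun ω =>
      mul_nonneg (sub_nonneg.2 (hw01 x ω).2) (abs_nonneg _))
  have hGint : ∀ x, Integrable (fun ω => (1 - (fkWeight v L t x ω).toReal) *
      |f (x + displacement t ω)|) (wienerPaths N) := fun x =>
    (integrable_const M).mono' (hGm.comp (measurable_const.prodMk measurable_id)).aestronglyMeasurable
      (Eventually.of_forall fun ω => by
        rw [Real.norm_eq_abs, abs_mul, abs_of_nonneg (sub_nonneg.2 (hw01 x ω).2), abs_abs]
        calc (1 - (fkWeight v L t x ω).toReal) * |f (x + displacement t ω)| ≤ 1 * M :=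
              mul_le_mul (by linarith [(hw01 x ω).1]) (hM _) (abs_nonneg _) zero_le_one
          _ = M := one_mul M)
  -- pointwise domination
  have hdom : ∀ x, f x * (∫ ω, f (x + displacement t ω) ∂wienerPaths N) - f x * fkReal v L t f x ≤
      |f x| * ∫ ω, (1 - (fkWeight v L t x ω).toReal) * |f (x + displacement t ω)| ∂wienerPaths N := by
    intro x
    rw [hdiff x]
    refine (le_abs_self _).trans ?_
    rw [abs_mul]
    gcongr
    refine (abs_integral_le_integral_abs).trans (le_of_eq (integral_congr_ae
      (Eventually.of_forall fun ω => ?_)))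
    simp only [abs_mul, abs_of_nonneg (sub_nonneg.2 (hw01 x ω).2)]
  -- Step A–F: reduce to the `lintegral` of `g` over the box
  have hlhs : (∫ x, f x * ∫ ω, f (x + displacement t ω) ∂wienerPaths N) -
      ∫ x in boxN N L, f x * fkReal v L t f x ≤
      (∫⁻ x in boxN N L, ENNReal.ofReal (|f x| *
        ∫ ω, (1 - (fkWeight v L t x ω).toReal) * |f (x + displacement t ω)| ∂wienerPaths N)).toReal := by
    rw [← setIntegral_eq_integral_of_forall_compl_eq_zero (s := boxN N L) (fun x hx => by
      rw [hzero x hx, zero_mul]), ← integral_sub hint1 hint2,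
      ← integral_eq_lintegral_of_nonneg_ae (Eventually.of_forall hg0) hg_meas.aestronglyMeasurable]
    exact integral_mono (hint1.sub hint2) ((integrable_const (M * M)).mono'
      hg_meas.aestronglyMeasurable (Eventually.of_forall fun x => by
        rw [Real.norm_eq_abs, abs_of_nonneg (hg0 x)]
        refine mul_le_mul (hM x) ?_ (integral_nonneg fun ω =>
          mul_nonneg (sub_nonneg.2 (hw01 x ω).2) (abs_nonneg _)) hM0
        have h := norm_integral_le_of_norm_le_const (μ := wienerPaths N)
          (f := fun ω => (1 - (fkWeight v L t x ω).toReal) * |f (x + displacement t ω)|) (C := M)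
          (Eventually.of_forall fun ω => by
            rw [Real.norm_eq_abs, abs_mul, abs_of_nonneg (sub_nonneg.2 (hw01 x ω).2), abs_abs]
            calc (1 - (fkWeight v L t x ω).toReal) * |f (x + displacement t ω)| ≤ 1 * M :=
                  mul_le_mul (by linarith [(hw01 x ω).1]) (hM _) (abs_nonneg _) zero_le_one
              _ = M := one_mul M)
        rw [probReal_univ, mul_one, Real.norm_eq_abs] at h
        exact (le_abs_self _).trans h)) hdom
  -- Step G: the `lintegral` of `g` is at most `K_t + J_t`
  have hFm : ∀ x, Measurable fun ω : PathSpace N => ‖f (x + displacement t ω)‖ₑ := fun x =>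
    (hf.comp ((measurable_displacement t).const_add x)).enorm
  have hpt : ∀ x, ENNReal.ofReal (|f x| *
      ∫ ω, (1 - (fkWeight v L t x ω).toReal) * |f (x + displacement t ω)| ∂wienerPaths N) ≤
      ‖f x‖ₑ * (∫⁻ ω, pathAction v t x ω * ‖f (worldLine x ω t)‖ₑ ∂wienerPaths N) +
        ∫⁻ ω, (survives L t x)ᶜ.indicator (1 : PathSpace N → ℝ≥0∞) ω *
          (‖f x‖ₑ * ‖f (x + displacement t ω)‖ₑ) ∂wienerPaths N := by
    intro x
    rw [ENNReal.ofReal_mul (abs_nonneg _), ← Real.enorm_eq_ofReal_abs,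
      ofReal_integral_eq_lintegral_ofReal (hGint x) (Eventually.of_forall fun ω =>
        mul_nonneg (sub_nonneg.2 (hw01 x ω).2) (abs_nonneg _))]
    have hin : ∫⁻ ω, ENNReal.ofReal ((1 - (fkWeight v L t x ω).toReal) * |f (x + displacement t ω)|)
        ∂wienerPaths N ≤
        (∫⁻ ω, pathAction v t x ω * ‖f (worldLine x ω t)‖ₑ ∂wienerPaths N) +
          ∫⁻ ω, (survives L t x)ᶜ.indicator (1 : PathSpace N → ℝ≥0∞) ω *
            ‖f (x + displacement t ω)‖ₑ ∂wienerPaths N := by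
      rw [← lintegral_add_left (f := fun ω => pathAction v t x ω * ‖f (worldLine x ω t)‖ₑ)
        ((measurable_pathAction hv t x).mul (hFm x))]
      refine lintegral_mono fun ω => ?_
      rw [ENNReal.ofReal_mul (sub_nonneg.2 (hw01 x ω).2), ← Real.enorm_eq_ofReal_abs]
      calc ENNReal.ofReal (1 - (fkWeight v L t x ω).toReal) * ‖f (x + displacement t ω)‖ₑ
          ≤ ((survives L t x)ᶜ.indicator (1 : PathSpace N → ℝ≥0∞) ω + pathAction v t x ω) *
              ‖f (x + displacement t ω)‖ₑ :=
            mul_le_mul' (ofReal_one_sub_fkWeight_le v L t x ω) le_rfl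
        _ = _ := by rw [add_mul, add_comm]; rfl
    calc ‖f x‖ₑ * ∫⁻ ω, ENNReal.ofReal ((1 - (fkWeight v L t x ω).toReal) *
          |f (x + displacement t ω)|) ∂wienerPaths N
        ≤ ‖f x‖ₑ * ((∫⁻ ω, pathAction v t x ω * ‖f (worldLine x ω t)‖ₑ ∂wienerPaths N) +
            ∫⁻ ω, (survives L t x)ᶜ.indicator (1 : PathSpace N → ℝ≥0∞) ω *
              ‖f (x + displacement t ω)‖ₑ ∂wienerPaths N) := mul_le_mul' le_rfl hin
      _ = _ := by
          rw [mul_add, ← lintegral_const_mul' _ (fun ω => (survives L t x)ᶜ.indicator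
            (1 : PathSpace N → ℝ≥0∞) ω * ‖f (x + displacement t ω)‖ₑ) enorm_ne_top]
          congr 1
          refine lintegral_congr fun ω => ?_
          ring
  have hJm : Measurable fun x => ‖f x‖ₑ *
      ∫⁻ ω, pathAction v t x ω * ‖f (worldLine x ω t)‖ₑ ∂wienerPaths N := by
    refine hf.enorm.mul ?_
    have h : Measurable fun p : Config N × PathSpace N =>
        pathAction v t p.1 p.2 * ‖f (worldLine p.1 p.2 t)‖ₑ :=
      (measurable_pathAction_uncurry hv t).mul hshift.enorm
    exact h.lintegral_prod_right'
  have hle : ∫⁻ x in boxN N L, ENNReal.ofReal (|f x| *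
      ∫ ω, (1 - (fkWeight v L t x ω).toReal) * |f (x + displacement t ω)| ∂wienerPaths N) ≤
      (∫⁻ x, ∫⁻ ω, (survives L t x)ᶜ.indicator (1 : PathSpace N → ℝ≥0∞) ω *
          (‖f x‖ₑ * ‖f (x + displacement t ω)‖ₑ) ∂wienerPaths N) +
        ∫⁻ x, ‖f x‖ₑ * ∫⁻ ω, pathAction v t x ω * ‖f (worldLine x ω t)‖ₑ ∂wienerPaths N := by
    calc ∫⁻ x in boxN N L, ENNReal.ofReal (|f x| *
          ∫ ω, (1 - (fkWeight v L t x ω).toReal) * |f (x + displacement t ω)| ∂wienerPaths N)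
        ≤ ∫⁻ x, ENNReal.ofReal (|f x| *
          ∫ ω, (1 - (fkWeight v L t x ω).toReal) * |f (x + displacement t ω)| ∂wienerPaths N) :=
          lintegral_mono' Measure.restrict_le_self le_rfl
      _ ≤ ∫⁻ x, (‖f x‖ₑ * (∫⁻ ω, pathAction v t x ω * ‖f (worldLine x ω t)‖ₑ ∂wienerPaths N) +
          ∫⁻ ω, (survives L t x)ᶜ.indicator (1 : PathSpace N → ℝ≥0∞) ω *
            (‖f x‖ₑ * ‖f (x + displacement t ω)‖ₑ) ∂wienerPaths N) := lintegral_mono hpt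
      _ = _ := by rw [lintegral_add_left hJm, add_comm]
  -- Step H: finiteness
  have hL1 : ∫⁻ x, ‖f x‖ₑ ≤ ENNReal.ofReal M * volume (boxN N L) := by
    calc ∫⁻ x, ‖f x‖ₑ ≤ ∫⁻ x, (boxN N L).indicator (fun _ => ENNReal.ofReal M) x := by
          refine lintegral_mono fun x => ?_
          by_cases hx : x ∈ boxN N L
          · rw [indicator_of_mem hx, Real.enorm_eq_ofReal_abs]; exact ENNReal.ofReal_le_ofReal (hM x)
          · rw [indicator_of_notMem hx, hzero x hx]; simp
      _ = _ := by rw [lintegral_indicator (measurableSet_boxN N L), setLIntegral_const]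
  have hL1top : ∫⁻ x, ‖f x‖ₑ ≠ ⊤ :=
    ne_top_of_le_ne_top (ENNReal.mul_ne_top ENNReal.ofReal_ne_top (volume_boxN_lt_top N L).ne) hL1
  have hFle : ∀ x ω, ‖f (x + displacement t ω)‖ₑ ≤ ENNReal.ofReal M := fun x ω => by
    rw [Real.enorm_eq_ofReal_abs]; exact ENNReal.ofReal_le_ofReal (hM _)
  have hKfin : ∫⁻ x, ∫⁻ ω, (survives L t x)ᶜ.indicator (1 : PathSpace N → ℝ≥0∞) ω *
      (‖f x‖ₑ * ‖f (x + displacement t ω)‖ₑ) ∂wienerPaths N ≠ ⊤ := by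
    refine ne_top_of_le_ne_top (b := ENNReal.ofReal M * ∫⁻ x, ‖f x‖ₑ)
      (ENNReal.mul_ne_top ENNReal.ofReal_ne_top hL1top) ?_
    calc ∫⁻ x, ∫⁻ ω, (survives L t x)ᶜ.indicator (1 : PathSpace N → ℝ≥0∞) ω *
          (‖f x‖ₑ * ‖f (x + displacement t ω)‖ₑ) ∂wienerPaths N
        ≤ ∫⁻ x, ∫⁻ _ω, ENNReal.ofReal M * ‖f x‖ₑ ∂wienerPaths N := by
          refine lintegral_mono fun x => lintegral_mono fun ω => ?_
          calc (survives L t x)ᶜ.indicator (1 : PathSpace N → ℝ≥0∞) ω *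
                (‖f x‖ₑ * ‖f (x + displacement t ω)‖ₑ)
              ≤ 1 * (‖f x‖ₑ * ENNReal.ofReal M) := by
                refine mul_le_mul' ?_ (mul_le_mul' le_rfl (hFle x ω))
                exact Set.indicator_le_self' (fun _ _ => zero_le_one) ω
            _ = ENNReal.ofReal M * ‖f x‖ₑ := by ring
      _ = ENNReal.ofReal M * ∫⁻ x, ‖f x‖ₑ := by
          simp only [lintegral_const, measure_univ, mul_one]
          rw [lintegral_const_mul' _ _ ENNReal.ofReal_ne_top]
  have hJfin : ∫⁻ x, ‖f x‖ₑ * ∫⁻ ω, pathAction v t x ω * ‖f (worldLine x ω t)‖ₑ ∂wienerPaths N ≠ ⊤ := by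
    have hA : ∀ (x : Config N) (ω : PathSpace N),
        pathAction v t x ω ≤ (N * N : ℕ) * C * ENNReal.ofReal t := fun x ω =>
      pathAction_le_of_le hC t x ω
    refine ne_top_of_le_ne_top
      (b := (N * N : ℕ) * C * ENNReal.ofReal t * ENNReal.ofReal M * ∫⁻ x, ‖f x‖ₑ)
      (ENNReal.mul_ne_top (ENNReal.mul_ne_top (ENNReal.mul_ne_top
      (ENNReal.mul_ne_top (ENNReal.natCast_ne_top _) ENNReal.coe_ne_top) ENNReal.ofReal_ne_top)
      ENNReal.ofReal_ne_top) hL1top) ?_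
    calc ∫⁻ x, ‖f x‖ₑ * ∫⁻ ω, pathAction v t x ω * ‖f (worldLine x ω t)‖ₑ ∂wienerPaths N
        ≤ ∫⁻ x, ‖f x‖ₑ * ∫⁻ _ω, (N * N : ℕ) * C * ENNReal.ofReal t * ENNReal.ofReal M ∂wienerPaths N := by
          refine lintegral_mono fun x => mul_le_mul' le_rfl (lintegral_mono fun ω => ?_)
          exact mul_le_mul' (hA x ω) (hFle x ω)
      _ = (N * N : ℕ) * C * ENNReal.ofReal t * ENNReal.ofReal M * ∫⁻ x, ‖f x‖ₑ := by
          simp only [lintegral_const, measure_univ, mul_one]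
          rw [← lintegral_const_mul' _ _ (ENNReal.mul_ne_top (ENNReal.mul_ne_top
            (ENNReal.mul_ne_top (ENNReal.natCast_ne_top _) ENNReal.coe_ne_top)
            ENNReal.ofReal_ne_top) ENNReal.ofReal_ne_top)]
          exact lintegral_congr fun x => by ring
  exact hlhs.trans (ENNReal.toReal_mono (ENNReal.add_ne_top.2 ⟨hKfin, hJfin⟩) hle)

end Difference

/-! ### The lower bound on real `C¹` Dirichlet functions -/

section Lower

variable {v : ℝ → ℝ≥0∞} {C : ℝ≥0} {L : ℝ}

/-- The dyadic times `2^{-n}` in `ℝ≥0`: positive, tending to `0` from the right. [folklore] -/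
theorem tendsto_dyadic_nhdsGT :
    Tendsto (fun n : ℕ => (((2 : ℝ≥0) ^ n)⁻¹ : ℝ≥0)) atTop (𝓝[>] 0) := by
  refine tendsto_nhdsWithin_iff.2 ⟨?_, Eventually.of_forall fun n => ?_⟩
  · rw [← NNReal.tendsto_coe]
    have h : (fun n : ℕ => (((((2 : ℝ≥0) ^ n)⁻¹ : ℝ≥0)) : ℝ)) = fun n => (((2 : ℝ) ^ n))⁻¹ := by
      funext n; simp
    rw [h, NNReal.coe_zero]
    exact tendsto_inv_atTop_zero.comp (tendsto_pow_atTop_atTop_of_one_lt one_lt_two)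
  · show (0 : ℝ≥0) < ((2 : ℝ≥0) ^ n)⁻¹
    positivity

/-- `(1 − μ₀^s)/s → −log μ₀` as `s → 0+` (`μ₀ > 0`). [folklore] -/
theorem tendsto_one_sub_rpow_div {μ₀ : ℝ} (hμ₀ : 0 < μ₀) :
    Tendsto (fun s : ℝ => (1 - μ₀ ^ s) / s) (𝓝[>] 0) (𝓝 (-Real.log μ₀)) := by
  have hd : HasDerivAt (fun x : ℝ => μ₀ ^ x) (μ₀ ^ (0 : ℝ) * Real.log μ₀) 0 :=
    (Real.hasStrictDerivAt_const_rpow hμ₀ 0).hasDerivAt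
  have h := hd.tendsto_slope_zero_right
  simp only [zero_add, Real.rpow_zero, one_mul, smul_eq_mul] at h
  have h' := h.neg
  refine h'.congr' (Eventually.of_forall fun s => ?_)
  simp only
  rw [div_eq_inv_mul]
  ring

/-- **The lower bound on real `C¹` Dirichlet functions**: for `f ∈ C¹((ℝ³)^N; ℝ)` vanishing
off the box `Λ_L^N` (`L ≥ 0`) and a measurable bounded pair profile `v`,
`−log ‖e^{−H_N}‖ · ∫ f² ≤ ∫ |∇f|² + ∫ V f²` — the semigroup bound `⟨f, T_t f⟩ ≤ ‖T_1‖^t ‖f‖²`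
expanded at `t = 2^{−n} → 0`. [cite: ChungZhao1995, Prop 3.29] -/
theorem negLog_mul_integral_sq_le (hv : Measurable v) (hC : ∀ r, v r ≤ C) (hL : 0 ≤ L)
    {f : Config N → ℝ} (hf1 : ContDiff ℝ 1 f) (hzero : ∀ x, x ∉ boxN N L → f x = 0) :
    -Real.log ‖fkL2 (N := N) v L 1‖ * ∫ x, f x ^ 2 ≤
      (∫⁻ x, realKinetic f x).toReal + (∫⁻ x, interaction v x * ‖f x‖ₑ ^ 2).toReal := by
  set μ₀ : ℝ := ‖fkL2 (N := N) v L 1‖ with hμ₀def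
  -- trivial case `μ₀ = 0`
  rcases eq_or_lt_of_le (norm_nonneg (fkL2 (N := N) v L 1)) with h0 | hμ₀
  · rw [hμ₀def, ← h0, Real.log_zero, neg_zero, zero_mul]; positivity
  rw [← hμ₀def] at hμ₀
  -- basic properties of `f`
  have hcont : Continuous f := hf1.continuous
  have hmeas : Measurable f := hcont.measurable
  have hsupp : HasCompactSupport f :=
    HasCompactSupport.intro' (isBounded_boxN N L).isCompact_closure isClosed_closure
      fun x hx => hzero x fun h => hx (subset_closure h)
  obtain ⟨M, hM⟩ := hcont.bounded_above_of_compact_support hsupp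
  have hM' : ∀ x, |f x| ≤ M := fun x => by rw [← Real.norm_eq_abs]; exact hM x
  have hM0 : 0 ≤ M := (abs_nonneg _).trans (hM' 0)
  obtain ⟨G, hG⟩ := (hf1.continuous_fderiv one_ne_zero).bounded_above_of_compact_support
    (hsupp.fderiv (𝕜 := ℝ))
  have hG0 : 0 ≤ G := le_trans (norm_nonneg (fderiv ℝ f 0)) (hG 0)
  have hLip : ∀ y z, |f y - f z| ≤ G * ‖y - z‖ := fun y z => by
    rw [← Real.norm_eq_abs]
    exact Convex.norm_image_sub_le_of_norm_fderiv_le (𝕜 := ℝ)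
      (fun w _ => hf1.differentiable one_ne_zero w) (fun w _ => hG w) convex_univ
      (mem_univ z) (mem_univ y)
  have hmem : MemLp f 2 volume := hcont.memLp_of_hasCompactSupport hsupp
  -- the energies
  set KE : ℝ≥0∞ := ∫⁻ x, realKinetic f x with hKEdef
  have hKE_top : KE ≠ ⊤ := by
    have hb : ∀ x, realKinetic f x ≤ (tsupport f).indicator
        (fun _ => ENNReal.ofReal ((3 * N : ℕ) * G ^ 2)) x := by
      intro x
      by_cases hx : x ∈ tsupport f
      · rw [indicator_of_mem hx, realKinetic_eq_ofReal]
        refine ENNReal.ofReal_le_ofReal ?_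
        calc ∑ i, ∑ k, (fderiv ℝ f x (Pi.single i (EuclideanSpace.single k (1 : ℝ)))) ^ 2
            ≤ ∑ _i : Fin N, ∑ _k : Fin 3, G ^ 2 := by
              refine Finset.sum_le_sum fun i _ => Finset.sum_le_sum fun k _ => ?_
              have h := (fderiv ℝ f x).le_opNorm (Pi.single i (EuclideanSpace.single k (1 : ℝ)))
              have hn : ‖(Pi.single i (EuclideanSpace.single k (1 : ℝ)) : Config N)‖ = 1 := by
                rw [Pi.norm_single, PiLp.norm_single, norm_one]
              rw [hn, mul_one, Real.norm_eq_abs] at h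
              have hab := abs_le.1 (h.trans (hG x))
              nlinarith [hab.1, hab.2]
          _ = (3 * N : ℕ) * G ^ 2 := by
              simp only [Finset.sum_const, Finset.card_univ, Fintype.card_fin, Nat.cast_mul,
                Nat.cast_ofNat]
              ring
      · rw [indicator_of_notMem hx, realKinetic_eq_ofReal, fderiv_of_notMem_tsupport ℝ hx]
        simp
    refine ne_top_of_le_ne_top ?_ (lintegral_mono hb)
    rw [lintegral_indicator hsupp.isClosed.measurableSet, setLIntegral_const]
    exact ENNReal.mul_ne_top ENNReal.ofReal_ne_top (hsupp.measure_lt_top).ne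
  set I : ℝ≥0∞ := ∫⁻ x, interaction v x * ‖f x‖ₑ ^ 2 with hIdef
  have hI_top : I ≠ ⊤ := by
    have hb : ∀ x, interaction v x * ‖f x‖ₑ ^ 2 ≤ (boxN N L).indicator
        (fun _ => (N * N : ℕ) * C * ENNReal.ofReal (M ^ 2)) x := by
      intro x
      by_cases hx : x ∈ boxN N L
      · rw [indicator_of_mem hx]
        refine mul_le_mul' (interaction_le_of_le hC x) ?_
        rw [Real.enorm_eq_ofReal_abs, ← ENNReal.ofReal_pow (abs_nonneg _), sq_abs]
        exact ENNReal.ofReal_le_ofReal (by nlinarith [abs_le.1 (hM' x), hM0])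
      · rw [indicator_of_notMem hx, hzero x hx]; simp
    refine ne_top_of_le_ne_top ?_ (lintegral_mono hb)
    rw [lintegral_indicator (measurableSet_boxN N L), setLIntegral_const]
    exact ENNReal.mul_ne_top (ENNReal.mul_ne_top (ENNReal.mul_ne_top (ENNReal.natCast_ne_top _)
      ENNReal.coe_ne_top) ENNReal.ofReal_ne_top) (volume_boxN_lt_top N L).ne
  -- `‖f‖²` over the whole space and over the box
  set n2 : ℝ := ∫ x, f x ^ 2 with hn2
  have hn2box : ∫ x in boxN N L, f x ^ 2 = n2 :=
    setIntegral_eq_integral_of_forall_compl_eq_zero fun x hx => by rw [hzero x hx]; ring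
  have hn2_nn : 0 ≤ n2 := integral_nonneg fun x => sq_nonneg _
  -- the times
  set tN : ℕ → ℝ≥0 := fun n => ((2 : ℝ≥0) ^ n)⁻¹ with htN
  have htpos : ∀ n, 0 < tN n := fun n => by simp only [htN]; positivity
  have htR : ∀ n, ((tN n : ℝ≥0) : ℝ) = ((2 : ℝ) ^ n)⁻¹ := fun n => by simp [htN]
  have htlim : Tendsto (fun n => ((tN n : ℝ≥0) : ℝ)) atTop (𝓝 0) := by
    have h : (fun n => ((tN n : ℝ≥0) : ℝ)) = fun n => ((2 : ℝ) ^ n)⁻¹ := funext htR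
    rw [h]
    exact tendsto_inv_atTop_zero.comp (tendsto_pow_atTop_atTop_of_one_lt one_lt_two)
  -- the terms `K_t`, `J_t`
  set K : ℕ → ℝ≥0∞ := fun n => ∫⁻ x, ∫⁻ ω, (survives L (tN n) x)ᶜ.indicator
    (1 : PathSpace N → ℝ≥0∞) ω * (‖f x‖ₑ * ‖f (x + displacement (tN n) ω)‖ₑ) ∂wienerPaths N with hKdef
  set J : ℕ → ℝ≥0∞ := fun n => ∫⁻ x, ‖f x‖ₑ * ∫⁻ ω, pathAction v (tN n) x ω *
    ‖f (worldLine x ω (tN n))‖ₑ ∂wienerPaths N with hJdef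
  -- the main inequality at each dyadic time
  have hmain : ∀ n, (1 - μ₀ ^ ((tN n : ℝ))) / (tN n : ℝ) * n2 ≤
      KE.toReal + ((K n + J n) / (tN n : ℝ≥0∞)).toReal := by
    intro n
    have ht0 : (0 : ℝ) < tN n := htpos n
    -- (A) pairing
    have hA : ∫ x in boxN N L, f x * fkReal v L (tN n) f x ≤ μ₀ ^ ((tN n : ℝ)) * n2 := by
      have h := setIntegral_mul_fkReal_le hv L ht0 hmeas hM'
      rw [hn2box, htR, norm_fkL2_dyadic hv L n] at h
      rwa [htR]
    -- (B) square identity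
    have hB := integral_mul_integral_shift_eq hmeas hmem (tN n)
    -- (C) the `C¹` bound
    have hC' : (sqIncr (tN n) f).toReal ≤ 2 * (tN n : ℝ) * KE.toReal := by
      have h := sqIncr_le_kinetic hf1 (tN n)
      have hfin : ENNReal.ofReal (2 * (tN n : ℝ)) * KE ≠ ⊤ :=
        ENNReal.mul_ne_top ENNReal.ofReal_ne_top hKE_top
      have := ENNReal.toReal_mono hfin h
      rwa [ENNReal.toReal_mul, ENNReal.toReal_ofReal (by positivity)] at this
    -- (D) the difference
    have hD := pairing_shift_sub_fkReal_le hv hC L (htpos n) hmeas hM' hzero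
    -- combine
    have hcomb : (1 - μ₀ ^ ((tN n : ℝ))) * n2 ≤ (tN n : ℝ) * KE.toReal + (K n + J n).toReal := by
      have h1 : (1 - μ₀ ^ ((tN n : ℝ))) * n2 ≤
          n2 - ∫ x in boxN N L, f x * fkReal v L (tN n) f x := by linarith
      have h2 : n2 - ∫ x in boxN N L, f x * fkReal v L (tN n) f x =
          (n2 - ∫ x, f x * ∫ ω, f (x + displacement (tN n) ω) ∂wienerPaths N) +
          ((∫ x, f x * ∫ ω, f (x + displacement (tN n) ω) ∂wienerPaths N) -
            ∫ x in boxN N L, f x * fkReal v L (tN n) f x) := by ring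
      have h3 : n2 - ∫ x, f x * ∫ ω, f (x + displacement (tN n) ω) ∂wienerPaths N =
          (sqIncr (tN n) f).toReal / 2 := by rw [hB]; ring
      rw [h2, h3] at h1
      have h4 : (sqIncr (tN n) f).toReal / 2 ≤ (tN n : ℝ) * KE.toReal := by linarith
      exact h1.trans (add_le_add h4 hD)
    rw [div_mul_eq_mul_div, div_le_iff₀ ht0]
    calc (1 - μ₀ ^ ((tN n : ℝ))) * n2 ≤ (tN n : ℝ) * KE.toReal + (K n + J n).toReal := hcomb
      _ = (KE.toReal + ((K n + J n) / (tN n : ℝ≥0∞)).toReal) * (tN n : ℝ) := by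
          rw [ENNReal.toReal_div, add_mul]
          have htne : ((tN n : ℝ≥0∞)).toReal = (tN n : ℝ) := rfl
          rw [htne, div_mul_cancel₀ _ ht0.ne']
          ring
  -- the limits of the two sides
  have hlhs : Tendsto (fun n => (1 - μ₀ ^ ((tN n : ℝ))) / (tN n : ℝ) * n2) atTop
      (𝓝 (-Real.log μ₀ * n2)) := by
    have h1 : Tendsto (fun n => ((tN n : ℝ≥0) : ℝ)) atTop (𝓝[>] 0) :=
      tendsto_nhdsWithin_iff.2 ⟨htlim, Eventually.of_forall fun n => htpos n⟩
    exact ((tendsto_one_sub_rpow_div hμ₀).comp h1).mul_const n2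
  have hK0 : Tendsto (fun n => K n / (tN n : ℝ≥0∞)) atTop (𝓝 0) := by
    set Cx : ℝ := 792 * Real.sqrt 2 * (N : ℝ) ^ 2 * G ^ 2 * L ^ (3 * N - 1) with hCx
    have hCx0 : 0 ≤ Cx := by positivity
    have hb : ∀ n, K n / (tN n : ℝ≥0∞) ≤ ENNReal.ofReal (Cx * Real.sqrt (tN n)) := by
      intro n
      have h := lintegral_exit_le (N := N) hL hzero hLip hG0 (t := tN n) (htpos n).ne'
      have ht0 : ((tN n : ℝ≥0∞)) ≠ 0 := by exact_mod_cast (htpos n).ne'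
      calc K n / (tN n : ℝ≥0∞) ≤ ENNReal.ofReal (Cx * ((tN n : ℝ) * Real.sqrt (tN n))) / (tN n : ℝ≥0∞) := by
            gcongr
        _ = ENNReal.ofReal (Cx * Real.sqrt (tN n)) * (tN n : ℝ≥0∞) / (tN n : ℝ≥0∞) := by
            congr 1
            rw [← ENNReal.ofReal_coe_nnreal, ← ENNReal.ofReal_mul (by positivity)]
            congr 1; ring
        _ = ENNReal.ofReal (Cx * Real.sqrt (tN n)) := ENNReal.mul_div_cancel_right ht0 ENNReal.coe_ne_top
    have hlim : Tendsto (fun n => ENNReal.ofReal (Cx * Real.sqrt (tN n))) atTop (𝓝 0) := by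
      have h2 := ((Real.continuous_sqrt.tendsto 0).comp htlim).const_mul Cx
      simp only [Function.comp_def, Real.sqrt_zero, mul_zero] at h2
      have h3 := ENNReal.tendsto_ofReal h2
      rwa [ENNReal.ofReal_zero] at h3
    exact tendsto_of_tendsto_of_tendsto_of_le_of_le tendsto_const_nhds hlim (fun n => bot_le) hb
  have hJ : Tendsto (fun n => J n / (tN n : ℝ≥0∞)) atTop (𝓝 I) :=
    (tendsto_interactionTerm_div (N := N) hv hC hcont hsupp).comp tendsto_dyadic_nhdsGT
  have hrhs : Tendsto (fun n => KE.toReal + ((K n + J n) / (tN n : ℝ≥0∞)).toReal) atTop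
      (𝓝 (KE.toReal + I.toReal)) := by
    have h1 : Tendsto (fun n => (K n + J n) / (tN n : ℝ≥0∞)) atTop (𝓝 I) := by
      have := hK0.add hJ
      rw [zero_add] at this
      refine this.congr fun n => ?_
      rw [ENNReal.add_div]
    exact ((ENNReal.tendsto_toReal hI_top).comp h1).const_add KE.toReal
  exact le_of_tendsto_of_tendsto' hlhs hrhs hmain

end Lower

/-! ### The lower bound on the variational energy -/

section Energy

variable {v : ℝ → ℝ≥0∞} {C : ℝ≥0} {L : ℝ}

/-- **The squared modulus splits into real and imaginary parts** (in `[0, ∞]`):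
`‖z‖² = (Re z)² + (Im z)²`, with `(‖r‖₊)² = ofReal (r²)` for the real parts. [folklore] -/
theorem coe_nnnorm_sq_complex_eq_add (z : ℂ) :
    ((‖z‖₊ : ℝ≥0∞)) ^ 2 = ((‖z.re‖₊ : ℝ≥0∞)) ^ 2 + ((‖z.im‖₊ : ℝ≥0∞)) ^ 2 := by
  have hR : ∀ r : ℝ, ((‖r‖₊ : ℝ≥0∞)) ^ 2 = ENNReal.ofReal (r ^ 2) := fun r => by
    rw [← enorm_eq_nnnorm, Real.enorm_eq_ofReal_abs, ← ENNReal.ofReal_pow (abs_nonneg _), sq_abs]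
  rw [hR, hR, ← enorm_eq_nnnorm, ← ofReal_norm, ← ENNReal.ofReal_pow (norm_nonneg _),
    ← ENNReal.ofReal_add (sq_nonneg _) (sq_nonneg _), ← Complex.normSq_eq_norm_sq,
    Complex.normSq_apply]
  congr 1; ring

/-- `(‖r‖ₑ)² = ofReal (r²)` for real `r`. [folklore] -/
theorem enorm_sq_eq_ofReal_sq (r : ℝ) : ‖r‖ₑ ^ 2 = ENNReal.ofReal (r ^ 2) := by
  rw [Real.enorm_eq_ofReal_abs, ← ENNReal.ofReal_pow (abs_nonneg _), sq_abs]

/-- **The kinetic density splits into real and imaginary parts**: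
`|∇ψ|² = |∇ Re ψ|² + |∇ Im ψ|²`. [folklore] -/
theorem kineticDensity_eq_realKinetic_add {ψ : Config N → ℂ} (hψ : Differentiable ℝ ψ)
    (X : Config N) :
    kineticDensity ψ X = realKinetic (fun Y => (ψ Y).re) X + realKinetic (fun Y => (ψ Y).im) X := by
  unfold kineticDensity realKinetic
  have hre : fderiv ℝ (fun Y => (ψ Y).re) X = Complex.reCLM.comp (fderiv ℝ ψ X) :=
    (Complex.reCLM.hasFDerivAt.comp X (hψ X).hasFDerivAt).fderiv
  have him : fderiv ℝ (fun Y => (ψ Y).im) X = Complex.imCLM.comp (fderiv ℝ ψ X) :=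
    (Complex.imCLM.hasFDerivAt.comp X (hψ X).hasFDerivAt).fderiv
  rw [← Finset.sum_add_distrib]
  refine Finset.sum_congr rfl fun i _ => ?_
  rw [← Finset.sum_add_distrib]
  refine Finset.sum_congr rfl fun k _ => ?_
  rw [hre, him, coe_nnnorm_sq_complex_eq_add]
  simp

/-- **`−log ‖e^{−H_N}‖ ≤ ⟨Ψ, H_N Ψ⟩` for every admissible trial state** (reduce to the real
and imaginary parts, both `C¹` Dirichlet functions, `∫ |Re Ψ|² + ∫ |Im Ψ|² = 1`).
[cite: ChungZhao1995, Prop 3.29] -/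
theorem ofReal_negLog_le_energy (hv : Measurable v) (hC : ∀ r, v r ≤ C) (hL : 0 ≤ L)
    (Ψ : TrialState N L) :
    ENNReal.ofReal (-Real.log ‖fkL2 (N := N) v L 1‖) ≤ energy v Ψ := by
  set lam : ℝ := -Real.log ‖fkL2 (N := N) v L 1‖ with hlam
  set u : Config N → ℝ := fun Y => (Ψ.ψ Y).re with hu
  set w : Config N → ℝ := fun Y => (Ψ.ψ Y).im with hw
  have hu1 : ContDiff ℝ 1 u := Complex.reCLM.contDiff.comp Ψ.contDiff
  have hw1 : ContDiff ℝ 1 w := Complex.imCLM.contDiff.comp Ψ.contDiff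
  have hu0 : ∀ x, x ∉ boxN N L → u x = 0 := fun x hx => by simp [hu, Ψ.eq_zero x hx]
  have hw0 : ∀ x, x ∉ boxN N L → w x = 0 := fun x hx => by simp [hw, Ψ.eq_zero x hx]
  have hsupp : ∀ {g : Config N → ℝ}, (∀ x, x ∉ boxN N L → g x = 0) → HasCompactSupport g :=
    fun hg => HasCompactSupport.intro' (isBounded_boxN N L).isCompact_closure isClosed_closure
      fun x hx => hg x fun h => hx (subset_closure h)
  -- the two real inequalities
  have hU := negLog_mul_integral_sq_le hv hC hL hu1 hu0
  have hW := negLog_mul_integral_sq_le hv hC hL hw1 hw0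
  -- the energies are finite sums
  set KEu : ℝ≥0∞ := ∫⁻ x, realKinetic u x
  set KEw : ℝ≥0∞ := ∫⁻ x, realKinetic w x
  set Iu : ℝ≥0∞ := ∫⁻ x, interaction v x * ‖u x‖ₑ ^ 2
  set Iw : ℝ≥0∞ := ∫⁻ x, interaction v x * ‖w x‖ₑ ^ 2
  have hsplit : energy v Ψ = (KEu + Iu) + (KEw + Iw) := by
    unfold energy
    have hpt : ∀ X, kineticDensity Ψ.ψ X + interaction v X * (‖Ψ.ψ X‖₊ : ℝ≥0∞) ^ 2 =
        (realKinetic u X + interaction v X * ‖u X‖ₑ ^ 2) +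
          (realKinetic w X + interaction v X * ‖w X‖ₑ ^ 2) := by
      intro X
      rw [kineticDensity_eq_realKinetic_add (Ψ.contDiff.differentiable one_ne_zero) X,
        coe_nnnorm_sq_complex_eq_add, ← enorm_eq_nnnorm, ← enorm_eq_nnnorm]
      ring
    simp_rw [hpt]
    have hmu : Measurable fun X => realKinetic u X + interaction v X * ‖u X‖ₑ ^ 2 :=
      (measurable_realKinetic hu1).add ((measurable_interaction hv).mul
        (hu1.continuous.measurable.enorm.pow_const 2))
    rw [lintegral_add_left hmu, lintegral_add_left (measurable_realKinetic hu1),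
      lintegral_add_left (measurable_realKinetic hw1)]
  -- the normalisation splits as well
  have hint : ∀ {g : Config N → ℝ}, ContDiff ℝ 1 g → (∀ x, x ∉ boxN N L → g x = 0) →
      Integrable (fun x => g x ^ 2) volume := by
    intro g hg hg0
    have : (fun x => g x ^ 2) = fun x => g x * g x := funext fun x => sq (g x)
    rw [this]
    exact (hg.continuous.mul hg.continuous).integrable_of_hasCompactSupport (hsupp hg0).mul_right
  have hnorm : (∫ x, u x ^ 2) + ∫ x, w x ^ 2 = 1 := by
    have h := Ψ.norm_eq
    have hpt : ∀ X, ((‖Ψ.ψ X‖₊ : ℝ≥0∞)) ^ 2 = ENNReal.ofReal (u X ^ 2) + ENNReal.ofReal (w X ^ 2) :=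
      fun X => by
        rw [coe_nnnorm_sq_complex_eq_add, ← enorm_eq_nnnorm, ← enorm_eq_nnnorm,
          enorm_sq_eq_ofReal_sq, enorm_sq_eq_ofReal_sq]
    simp_rw [hpt] at h
    rw [lintegral_add_left (hu1.continuous.measurable.pow_const 2).ennreal_ofReal] at h
    have hfu : ∫⁻ x, ENNReal.ofReal (u x ^ 2) ≠ ⊤ :=
      ne_top_of_le_ne_top ENNReal.one_ne_top (le_trans le_self_add h.le)
    have hfw : ∫⁻ x, ENNReal.ofReal (w x ^ 2) ≠ ⊤ :=
      ne_top_of_le_ne_top ENNReal.one_ne_top (le_trans le_add_self h.le)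
    have h' := congrArg ENNReal.toReal h
    rw [ENNReal.toReal_add hfu hfw, ENNReal.toReal_one, toReal_lintegral_sq (hint hu1 hu0),
      toReal_lintegral_sq (hint hw1 hw0)] at h'
    exact h'
  -- conclude
  have hpart : ∀ {K I : ℝ≥0∞} {c : ℝ}, c ≤ K.toReal + I.toReal → ENNReal.ofReal c ≤ K + I := by
    intro K I c hc
    by_cases htop : K + I = ⊤
    · rw [htop]; exact le_top
    · refine ENNReal.ofReal_le_of_le_toReal ?_
      rwa [ENNReal.toReal_add (ENNReal.add_ne_top.1 htop).1 (ENNReal.add_ne_top.1 htop).2]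
  rw [hsplit]
  calc ENNReal.ofReal lam = ENNReal.ofReal (lam * (∫ x, u x ^ 2) + lam * ∫ x, w x ^ 2) := by
        rw [← mul_add, hnorm, mul_one]
    _ ≤ ENNReal.ofReal (lam * ∫ x, u x ^ 2) + ENNReal.ofReal (lam * ∫ x, w x ^ 2) :=
        ENNReal.ofReal_add_le
    _ ≤ (KEu + Iu) + (KEw + Iw) := add_le_add (hpart hU) (hpart hW)

/-- **`−log ‖e^{−H_N}‖_{L²(Λ)→L²(Λ)} ≤ E₀(N, L)`**: the top of the spectrum of the Feynman–Kac
semigroup bounds the variational ground-state energy from below (the lower-bound half of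
Chung–Zhao Thm 3.27 / Prop 3.29 (81) for the killed Brownian motion with the bounded potential
`−V` in the box). [cite: ChungZhao1995, Prop 3.29] -/
theorem ofReal_negLog_le_groundStateEnergy (hv : Measurable v) (hC : ∀ r, v r ≤ C) (N : ℕ)
    (hL : 0 ≤ L) :
    ENNReal.ofReal (-Real.log ‖fkL2 (N := N) v L 1‖) ≤ groundStateEnergy v N L :=
  le_iInf fun Ψ => ofReal_negLog_le_energy hv hC hL Ψ

end Energy

end Literature.MathematicalPhysics.QuantumManyBody.BoseGas
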